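import Mathlib
import Summits.Ventures.PercRepro2.Defs
import Summits.Ventures.PercRepro2.Harris
import Summits.Ventures.PercRepro2.Graph
import Summits.Ventures.PercRepro2.Events
import Summits.Ventures.PercRepro2.BHKAvoidWeighted
import Summits.Ventures.PercRepro2.PsiPendantLemmas
import Summits.Ventures.PercRepro2.PsiUniIsolated

/-!
# The one-edge pinning property (UNI) when `Q` and `{o ∈ C_t}` are deterministic (PercRepro2, p2)

`PsiPinInduction.lean` reduces the (Ψ) inequality of the (PM⁺) line to the one-edge property
(UNI_f): `min (Σ_𝓤(p[f↦0])) (Σ_𝓤(p[f↦1])) ≤ Σ_𝓤(p)` for SOME unpinned edge `f` of every instance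
(`Σ_𝓤` = the multiplied-out (Ψ)-slack `Ug·((q − aH)·oL + q·(oLH + oHH) − aH·oH) − oLU·q²`).
`PsiUniIsolated.lean` proves (UNI_f) for every edge when every edge at `t` is pinned closed.  This
file proves it in the GENERAL deterministic regime the `t`-exploration ends in (P2-G17-PSI.md §6.2,
§8.3): the hypotheses are only that `Q = {s ↮ t}` is sure or null and that `{t ↔ o}` is sure or null
under `p`.  Three collapses of the slack: `Q` sure and `o ∉ C_t` — `Σ = Ug·(oHH − aH·oH)` (then
Harris + the super-linear one-edge covariance + AM–GM of `PsiUniIsolated.lean`); `o ∈ C_t` sure —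
`Σ = 0` identically (`oL = q`, `oLH = aH`, `oLU = Ug`, `oH = oHH = 0`); `Q` null — every mass is `0`.
Along an unpinned edge a null (sure) event stays null (sure) at both pins (the pinning identity with
positive mixing weights), so the three collapses hold at `p`, `p[f↦0]` and `p[f↦1]` alike.

* `prob_inter_eq_zero_of_right`, `prob_inter_compl_of_eq_zero`, `prob_inter_of_eq_one` — null / sure
  events inside intersections;
* `prob_update_eq_zero_of_eq_zero`, `prob_update_eq_one_of_eq_one` — null / sure events at both pins
  of an unpinned edge;
* `psi_slack_eq_of_sure_avoid`, `psi_slack_eq_zero_of_sure_contain`, `psi_slack_eq_zero_of_Q_null` —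
  the three collapses of the slack;
* `psi_uni_of_sure` — **(UNI_f) for every edge when `Q` and `{t ↔ o}` are deterministic**.
-/

namespace Summit.Ventures.PercRepro2

section NullSure

variable {E : Type*} [Fintype E] [DecidableEq E] {R : Type*} [CommRing R] [LinearOrder R]
  [IsStrictOrderedRing R]

/-- A sub-event of a null event is null. -/
lemma prob_inter_eq_zero_of_right {p : E → R} (hp : IsProbVec p) {B : Set (Config E)}
    (hB : prob p B = 0) (A : Set (Config E)) : prob p (A ∩ B) = 0 :=
  le_antisymm ((prob_mono hp Set.inter_subset_right).trans hB.le) (prob_nonneg hp _)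

/-- Intersecting with the complement of a null event changes no probability. -/
lemma prob_inter_compl_of_eq_zero {p : E → R} (hp : IsProbVec p) {B : Set (Config E)}
    (hB : prob p B = 0) (A : Set (Config E)) : prob p (A ∩ Bᶜ) = prob p A := by
  have h := prob_inter_add_prob_inter_compl p A B
  rw [prob_inter_eq_zero_of_right hp hB, zero_add] at h
  exact h

/-- Intersecting with a sure event changes no probability. -/
lemma prob_inter_of_eq_one {p : E → R} (hp : IsProbVec p) {B : Set (Config E)}
    (hB : prob p B = 1) (A : Set (Config E)) : prob p (A ∩ B) = prob p A := by
  have hBc : prob p Bᶜ = 0 := by rw [prob_compl, hB, sub_self]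
  have h := prob_inter_compl_of_eq_zero hp hBc A
  rwa [compl_compl] at h

/-- Along an unpinned edge a null event is null at both pins. -/
lemma prob_update_eq_zero_of_eq_zero {p : E → R} (hp : IsProbVec p) {f : E} (hf0 : p f ≠ 0)
    (hf1 : p f ≠ 1) {A : Set (Config E)} (hA : prob p A = 0) :
    prob (Function.update p f 0) A = 0 ∧ prob (Function.update p f 1) A = 0 := by
  have hw : 0 < p f := lt_of_le_of_ne (hp.nonneg f) (Ne.symm hf0)
  have hw1 : 0 < 1 - p f := sub_pos.2 (lt_of_le_of_ne (hp.le_one f) hf1)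
  have h0 := prob_nonneg (hp.update f le_rfl zero_le_one) A
  have h1 := prob_nonneg (hp.update f zero_le_one le_rfl) A
  rw [prob_eq_pin p A f] at hA
  constructor
  · by_contra hne
    have hpos : 0 < prob (Function.update p f 0) A := lt_of_le_of_ne h0 (Ne.symm hne)
    nlinarith [mul_pos hw1 hpos, mul_nonneg hw.le h1]
  · by_contra hne
    have hpos : 0 < prob (Function.update p f 1) A := lt_of_le_of_ne h1 (Ne.symm hne)
    nlinarith [mul_pos hw hpos, mul_nonneg hw1.le h0]

/-- Along an unpinned edge a sure event is sure at both pins. -/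
lemma prob_update_eq_one_of_eq_one {p : E → R} (hp : IsProbVec p) {f : E} (hf0 : p f ≠ 0)
    (hf1 : p f ≠ 1) {A : Set (Config E)} (hA : prob p A = 1) :
    prob (Function.update p f 0) A = 1 ∧ prob (Function.update p f 1) A = 1 := by
  have hAc : prob p Aᶜ = 0 := by rw [prob_compl, hA, sub_self]
  obtain ⟨h0, h1⟩ := prob_update_eq_zero_of_eq_zero hp hf0 hf1 hAc
  rw [prob_compl] at h0 h1
  constructor <;> linarith

end NullSure

section Collapse

variable {V : Type*} {E : Type*} [Fintype E] [DecidableEq E] {R : Type*} [CommRing R]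
  [LinearOrder R] [IsStrictOrderedRing R]

/-- With `Q` sure and `{t ↔ o}` null the (Ψ)-slack collapses to `Ug·(oHH − aH·oH)`. -/
lemma psi_slack_eq_of_sure_avoid (p : E → R) (hp : IsProbVec p) (ends : E → Sym2 V)
    (s t o u : V) (hQ : prob p (connEvent ends s t) = 0) (ho : prob p (connEvent ends t o) = 0)
    (𝓤 : Set (Set V)) :
    (prob p (clusterInEvent ends s 𝓤 ∩ (connEvent ends s t)ᶜ) *
        ((prob p (connEvent ends s t)ᶜ - prob p (connEvent ends s u ∩ (connEvent ends s t)ᶜ)) *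
            prob p (clusterInEvent ends t {W : Set V | o ∈ W} ∩ (connEvent ends s t)ᶜ) +
          prob p (connEvent ends s t)ᶜ *
            (prob p (connEvent ends s u ∩ clusterInEvent ends t {W : Set V | o ∈ W} ∩
          (connEvent ends s t)ᶜ) +
              prob p (connEvent ends s u ∩ clusterInEvent ends s {W : Set V | o ∈ W} ∩
          (connEvent ends s t)ᶜ)) -
          prob p (connEvent ends s u ∩ (connEvent ends s t)ᶜ) *
            prob p (clusterInEvent ends s {W : Set V | o ∈ W} ∩ (connEvent ends s t)ᶜ)) -
      prob p (clusterInEvent ends s 𝓤 ∩ clusterInEvent ends t {W : Set V | o ∈ W} ∩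
          (connEvent ends s t)ᶜ) * prob p (connEvent ends s t)ᶜ * prob p (connEvent ends s t)ᶜ) =
      prob p (clusterInEvent ends s 𝓤) *
        (prob p (connEvent ends s u ∩ clusterInEvent ends s {W : Set V | o ∈ W}) -
          prob p (connEvent ends s u) * prob p (clusterInEvent ends s {W : Set V | o ∈ W})) := by
  have hQc : prob p (connEvent ends s t)ᶜ = 1 := by rw [prob_compl, hQ, sub_zero]
  have hO : prob p (clusterInEvent ends t {W : Set V | o ∈ W}) = 0 := by
    rw [clusterInEvent_memFamily_eq_connEvent]; exact ho
  rw [hQc]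
  simp only [prob_inter_compl_of_eq_zero hp hQ]
  rw [prob_inter_eq_zero_of_right hp hO, prob_inter_eq_zero_of_right hp hO, hO]
  ring

omit [Fintype E] [DecidableEq E] [LinearOrder R] [IsStrictOrderedRing R] in
/-- `{s ↔ o} ∩ {s ↮ t} ∩ {t ↔ o}` is empty. -/
lemma clusterInEvent_s_inter_compl_inter_clusterInEvent_t_eq_empty (ends : E → Sym2 V)
    (s t o : V) :
    clusterInEvent ends s {W : Set V | o ∈ W} ∩ (connEvent ends s t)ᶜ ∩
      clusterInEvent ends t {W : Set V | o ∈ W} = (∅ : Set (Config E)) := by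
  ext ω
  simp only [Set.mem_inter_iff, mem_clusterInEvent, Set.mem_setOf_eq, mem_cluster, Set.mem_compl_iff,
    mem_connEvent, Set.mem_empty_iff_false, iff_false, not_and]
  rintro ⟨hso, hst⟩ hto
  exact hst (conn_trans hso (conn_symm hto))

/-- With `{t ↔ o}` sure the (Ψ)-slack vanishes identically. -/
lemma psi_slack_eq_zero_of_sure_contain (p : E → R) (hp : IsProbVec p) (ends : E → Sym2 V)
    (s t o u : V) (ho : prob p (connEvent ends t o) = 1) (𝓤 : Set (Set V)) :
    (prob p (clusterInEvent ends s 𝓤 ∩ (connEvent ends s t)ᶜ) *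
        ((prob p (connEvent ends s t)ᶜ - prob p (connEvent ends s u ∩ (connEvent ends s t)ᶜ)) *
            prob p (clusterInEvent ends t {W : Set V | o ∈ W} ∩ (connEvent ends s t)ᶜ) +
          prob p (connEvent ends s t)ᶜ *
            (prob p (connEvent ends s u ∩ clusterInEvent ends t {W : Set V | o ∈ W} ∩
          (connEvent ends s t)ᶜ) +
              prob p (connEvent ends s u ∩ clusterInEvent ends s {W : Set V | o ∈ W} ∩
          (connEvent ends s t)ᶜ)) -
          prob p (connEvent ends s u ∩ (connEvent ends s t)ᶜ) *
            prob p (clusterInEvent ends s {W : Set V | o ∈ W} ∩ (connEvent ends s t)ᶜ)) -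
      prob p (clusterInEvent ends s 𝓤 ∩ clusterInEvent ends t {W : Set V | o ∈ W} ∩
          (connEvent ends s t)ᶜ) * prob p (connEvent ends s t)ᶜ * prob p (connEvent ends s t)ᶜ) = 0 := by
  have hO : prob p (clusterInEvent ends t {W : Set V | o ∈ W}) = 1 := by
    rw [clusterInEvent_memFamily_eq_connEvent]; exact ho
  have h1 : prob p (clusterInEvent ends t {W : Set V | o ∈ W} ∩ (connEvent ends s t)ᶜ) =
      prob p (connEvent ends s t)ᶜ := by
    rw [Set.inter_comm]; exact prob_inter_of_eq_one hp hO _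
  have h2 : prob p (connEvent ends s u ∩ clusterInEvent ends t {W : Set V | o ∈ W} ∩
      (connEvent ends s t)ᶜ) = prob p (connEvent ends s u ∩ (connEvent ends s t)ᶜ) := by
    rw [Set.inter_right_comm]; exact prob_inter_of_eq_one hp hO _
  have h3 : prob p (clusterInEvent ends s 𝓤 ∩ clusterInEvent ends t {W : Set V | o ∈ W} ∩
      (connEvent ends s t)ᶜ) = prob p (clusterInEvent ends s 𝓤 ∩ (connEvent ends s t)ᶜ) := by
    rw [Set.inter_right_comm]; exact prob_inter_of_eq_one hp hO _
  have h4 : prob p (clusterInEvent ends s {W : Set V | o ∈ W} ∩ (connEvent ends s t)ᶜ) = 0 := by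
    rw [← prob_inter_of_eq_one hp hO,
      clusterInEvent_s_inter_compl_inter_clusterInEvent_t_eq_empty, prob_empty]
  have h5 : prob p (connEvent ends s u ∩ clusterInEvent ends s {W : Set V | o ∈ W} ∩
      (connEvent ends s t)ᶜ) = 0 := by
    apply le_antisymm _ (prob_nonneg hp _)
    rw [← h4]
    refine prob_mono hp ?_
    rw [Set.inter_assoc]
    exact Set.inter_subset_right
  rw [h1, h2, h3, h4, h5]
  ring

/-- With `Q` null every mass of the (Ψ)-slack vanishes, hence the slack. -/
lemma psi_slack_eq_zero_of_Q_null (p : E → R) (hp : IsProbVec p) (ends : E → Sym2 V)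
    (s t o u : V) (hQ : prob p (connEvent ends s t) = 1) (𝓤 : Set (Set V)) :
    (prob p (clusterInEvent ends s 𝓤 ∩ (connEvent ends s t)ᶜ) *
        ((prob p (connEvent ends s t)ᶜ - prob p (connEvent ends s u ∩ (connEvent ends s t)ᶜ)) *
            prob p (clusterInEvent ends t {W : Set V | o ∈ W} ∩ (connEvent ends s t)ᶜ) +
          prob p (connEvent ends s t)ᶜ *
            (prob p (connEvent ends s u ∩ clusterInEvent ends t {W : Set V | o ∈ W} ∩
          (connEvent ends s t)ᶜ) +
              prob p (connEvent ends s u ∩ clusterInEvent ends s {W : Set V | o ∈ W} ∩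
          (connEvent ends s t)ᶜ)) -
          prob p (connEvent ends s u ∩ (connEvent ends s t)ᶜ) *
            prob p (clusterInEvent ends s {W : Set V | o ∈ W} ∩ (connEvent ends s t)ᶜ)) -
      prob p (clusterInEvent ends s 𝓤 ∩ clusterInEvent ends t {W : Set V | o ∈ W} ∩
          (connEvent ends s t)ᶜ) * prob p (connEvent ends s t)ᶜ * prob p (connEvent ends s t)ᶜ) = 0 := by
  have hQc : prob p (connEvent ends s t)ᶜ = 0 := by rw [prob_compl, hQ, sub_self]
  simp only [prob_inter_eq_zero_of_right hp hQc, hQc]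
  ring

end Collapse

section UniSure

variable {V : Type*} {E : Type*} [Fintype E] [DecidableEq E]
  {R : Type*} [CommRing R] [LinearOrder R] [IsStrictOrderedRing R]

/-- **(UNI_f) for every edge when `Q` and `{t ↔ o}` are deterministic.** If `Q = {s ↮ t}` is sure
or null and `{t ↔ o}` is sure or null under `p`, then for every family `𝓤` and every edge `f` the
(Ψ)-slack under `p` dominates the smaller of its values with `f` pinned closed / open. -/
theorem psi_uni_of_sure (p : E → R) (hp : IsProbVec p) (ends : E → Sym2 V) (s t o u : V)
    (hQ : prob p (connEvent ends s t) = 0 ∨ prob p (connEvent ends s t) = 1)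
    (ho : prob p (connEvent ends t o) = 0 ∨ prob p (connEvent ends t o) = 1)
    (𝓤 : Set (Set V)) (f : E) :
    min (prob (Function.update p f 0) (clusterInEvent ends s 𝓤 ∩ (connEvent ends s t)ᶜ) *
        ((prob (Function.update p f 0) (connEvent ends s t)ᶜ - prob (Function.update p f 0) (connEvent ends s u ∩ (connEvent ends s t)ᶜ)) *
            prob (Function.update p f 0) (clusterInEvent ends t {W : Set V | o ∈ W} ∩ (connEvent ends s t)ᶜ) +
          prob (Function.update p f 0) (connEvent ends s t)ᶜ *
            (prob (Function.update p f 0) (connEvent ends s u ∩ clusterInEvent ends t {W : Set V | o ∈ W} ∩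
          (connEvent ends s t)ᶜ) +
              prob (Function.update p f 0) (connEvent ends s u ∩ clusterInEvent ends s {W : Set V | o ∈ W} ∩
          (connEvent ends s t)ᶜ)) -
          prob (Function.update p f 0) (connEvent ends s u ∩ (connEvent ends s t)ᶜ) *
            prob (Function.update p f 0) (clusterInEvent ends s {W : Set V | o ∈ W} ∩ (connEvent ends s t)ᶜ)) -
      prob (Function.update p f 0) (clusterInEvent ends s 𝓤 ∩ clusterInEvent ends t {W : Set V | o ∈ W} ∩
          (connEvent ends s t)ᶜ) * prob (Function.update p f 0) (connEvent ends s t)ᶜ * prob (Function.update p f 0) (connEvent ends s t)ᶜ) (prob (Function.update p f 1) (clusterInEvent ends s 𝓤 ∩ (connEvent ends s t)ᶜ) *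
        ((prob (Function.update p f 1) (connEvent ends s t)ᶜ - prob (Function.update p f 1) (connEvent ends s u ∩ (connEvent ends s t)ᶜ)) *
            prob (Function.update p f 1) (clusterInEvent ends t {W : Set V | o ∈ W} ∩ (connEvent ends s t)ᶜ) +
          prob (Function.update p f 1) (connEvent ends s t)ᶜ *
            (prob (Function.update p f 1) (connEvent ends s u ∩ clusterInEvent ends t {W : Set V | o ∈ W} ∩
          (connEvent ends s t)ᶜ) +
              prob (Function.update p f 1) (connEvent ends s u ∩ clusterInEvent ends s {W : Set V | o ∈ W} ∩
          (connEvent ends s t)ᶜ)) -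
          prob (Function.update p f 1) (connEvent ends s u ∩ (connEvent ends s t)ᶜ) *
            prob (Function.update p f 1) (clusterInEvent ends s {W : Set V | o ∈ W} ∩ (connEvent ends s t)ᶜ)) -
      prob (Function.update p f 1) (clusterInEvent ends s 𝓤 ∩ clusterInEvent ends t {W : Set V | o ∈ W} ∩
          (connEvent ends s t)ᶜ) * prob (Function.update p f 1) (connEvent ends s t)ᶜ * prob (Function.update p f 1) (connEvent ends s t)ᶜ) ≤ (prob p (clusterInEvent ends s 𝓤 ∩ (connEvent ends s t)ᶜ) *
        ((prob p (connEvent ends s t)ᶜ - prob p (connEvent ends s u ∩ (connEvent ends s t)ᶜ)) *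
            prob p (clusterInEvent ends t {W : Set V | o ∈ W} ∩ (connEvent ends s t)ᶜ) +
          prob p (connEvent ends s t)ᶜ *
            (prob p (connEvent ends s u ∩ clusterInEvent ends t {W : Set V | o ∈ W} ∩
          (connEvent ends s t)ᶜ) +
              prob p (connEvent ends s u ∩ clusterInEvent ends s {W : Set V | o ∈ W} ∩
          (connEvent ends s t)ᶜ)) -
          prob p (connEvent ends s u ∩ (connEvent ends s t)ᶜ) *
            prob p (clusterInEvent ends s {W : Set V | o ∈ W} ∩ (connEvent ends s t)ᶜ)) -
      prob p (clusterInEvent ends s 𝓤 ∩ clusterInEvent ends t {W : Set V | o ∈ W} ∩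
          (connEvent ends s t)ᶜ) * prob p (connEvent ends s t)ᶜ * prob p (connEvent ends s t)ᶜ) := by
  by_cases hf0 : p f = 0
  · have hpf : Function.update p f 0 = p := by
      rw [← hf0]; exact Function.update_eq_self f p
    rw [hpf]
    exact min_le_left _ _
  by_cases hf1 : p f = 1
  · have hpf : Function.update p f 1 = p := by
      rw [← hf1]; exact Function.update_eq_self f p
    rw [hpf]
    exact min_le_right _ _
  have hw : 0 ≤ p f := hp.nonneg f
  have hw1 : p f ≤ 1 := hp.le_one f
  have hp0 : IsProbVec (Function.update p f 0) := hp.update f le_rfl zero_le_one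
  have hp1 : IsProbVec (Function.update p f 1) := hp.update f zero_le_one le_rfl
  rcases hQ with hQ | hQ
  · obtain ⟨hQ0, hQ1⟩ := prob_update_eq_zero_of_eq_zero hp hf0 hf1 hQ
    rcases ho with ho | ho
    · -- `Q` sure, `o ∉ C_t`: Harris, the super-linear covariance and AM–GM
      obtain ⟨ho0, ho1⟩ := prob_update_eq_zero_of_eq_zero hp hf0 hf1 ho
      rw [psi_slack_eq_of_sure_avoid p hp ends s t o u hQ ho 𝓤,
        psi_slack_eq_of_sure_avoid _ hp0 ends s t o u hQ0 ho0 𝓤,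
        psi_slack_eq_of_sure_avoid _ hp1 ends s t o u hQ1 ho1 𝓤]
      have hAU : IsUpperSet (connEvent ends s u) := isUpperSet_connEvent ends s u
      have hOH : IsUpperSet (clusterInEvent ends s {W : Set V | o ∈ W}) :=
        isUpperSet_clusterInEvent ends s (isUpperSet_memFamily o)
      have mono : ∀ {A : Set (Config E)}, IsUpperSet A →
          prob (Function.update p f 0) A ≤ prob (Function.update p f 1) A := fun hA =>
        prob_update_zero_le_prob_update_one hp f
          (fun ω hω => hA (update_false_le_update_true ω f) hω)
      have eU := prob_eq_pin p (clusterInEvent ends s 𝓤) f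
      have eA := prob_eq_pin p (connEvent ends s u) f
      have eO := prob_eq_pin p (clusterInEvent ends s {W : Set V | o ∈ W}) f
      have eX := prob_eq_pin p (connEvent ends s u ∩ clusterInEvent ends s {W : Set V | o ∈ W}) f
      rw [eU, eA, eO, eX]
      exact uni_isolated_algebra hw hw1 (prob_nonneg hp0 _) (prob_nonneg hp1 _) (mono hAU)
        (mono hOH) (prob_mul_prob_le_prob_inter hp0 hAU hOH)
        (prob_mul_prob_le_prob_inter hp1 hAU hOH)
    · -- `o ∈ C_t` sure: the slack vanishes identically
      obtain ⟨ho0, ho1⟩ := prob_update_eq_one_of_eq_one hp hf0 hf1 ho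
      rw [psi_slack_eq_zero_of_sure_contain p hp ends s t o u ho 𝓤,
        psi_slack_eq_zero_of_sure_contain _ hp0 ends s t o u ho0 𝓤,
        psi_slack_eq_zero_of_sure_contain _ hp1 ends s t o u ho1 𝓤]
      simp
  · -- `Q` null: the slack vanishes identically
    obtain ⟨hQ0, hQ1⟩ := prob_update_eq_one_of_eq_one hp hf0 hf1 hQ
    rw [psi_slack_eq_zero_of_Q_null p hp ends s t o u hQ 𝓤,
      psi_slack_eq_zero_of_Q_null _ hp0 ends s t o u hQ0 𝓤,
      psi_slack_eq_zero_of_Q_null _ hp1 ends s t o u hQ1 𝓤]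
    simp

end UniSure

end Summit.Ventures.PercRepro2
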